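import Summits.Ventures.CertifiedManyBodySolver.Upper.UMPSBondBookkeeping
import HarnessLib

/-!
# uMPS upper bound for the Hubbard chain, II: Theorem U1 (uMPS dual certificate ⇒ TL upper bound)

HONEST FRAMING: first certified bounds; not a superconductivity verdict; every number certified or
labelled float.

Venture `Ventures/CertifiedManyBodySolver` (sr-mbsolver). **Theorem U1** of VAR's `METHOD-umps.md`
(v1.1, refereed line by line by ref-2, R2.1), assembled from tree theorems:

* (a)+(b) tensor side — `Upper/UMPSDualBound.lean` (`re_sum_star_mpsOpen_dotProduct_bondSum_mulVec_le`,
  lit-4 p238610) on top of the open-MPS product formula (`OpenMPSProductExpectation`, p237173);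
* the site-major Jordan–Wigner identification — `HubbardJordanWigner.lean` (`JordanWigner.toSpin`,
  lit-1 p238277);
* (c) bookkeeping — `Upper/UMPSBondBookkeeping.lean` (`bookkeeping_le`);
* (d) sectors + particle–hole pairing + free cut — `HubbardChainGrandCanonicalUpperBound.lean`
  (`groundEnergyAt_pathGraph_double_le_re_trace`, lit-4 p237996);
* (e) the limit — `hubbardChainEnergyDensity_le_segment` (`HubbardChainSegmentUpperBound.lean`).

Main results (`A : MPSTensor 4 D` over `ℂ`, LEFT-ISOMETRIC `Σ_s (A s)ᴴ A s = 1`, `0 < D`, `U ≥ 0`,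
any `Z`, reals `c, z` with the three positive-semidefiniteness certificates
`c·1 − W(A; g(t,U), Z) ⪰ 0`, `z·1 − Z ⪰ 0`, `z·1 + Z ⪰ 0`, `W = Y_g + Φ(Z) − Z` as in
`UMPSDualBound`, `g = bondMatrix t U` as in `UMPSBondBookkeeping`):

* `trialDensity A r n` — the finitely-correlated trial density matrix
  `ρ = Σ_l |ψ̃_l⟩⟨ψ̃_l|` on the Fock space of the open chain of `n + 2` sites
  (`ψ̃_l` = Jordan–Wigner preimage of the open MPS vector `mpsOpen (n+2) A e_l r`), positive
  semidefinite of trace `‖r‖²`, with `Tr(ρ X) = mixture(toSpin X)`;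
* `groundEnergyAt_pathGraph_double_le_of_umps_dual` — for every `n`,
  `E_{path(2n+4)}(2n+4) ≤ 2((n+1)c + 2z) + 3U`;
* `hubbardChainEnergyDensity_le_of_umps_dual` — **Theorem U1**: `hubbardChainEnergyDensity t U ≤ c`.

Physical-index convention: the tree's (`FermionicPEPS.siteOcc`): `0 = ∅, 1 = ↑, 2 = ↓, 3 = ↑↓`;
VAR's `s = 2n↑ + n↓` differs by the swap `1 ↔ 2` (permute the physical leg of `A` in the instance).
Real certificates: complex matrices with real (rational) entries, `ᴴ = ᵀ`. A certificate row
instantiates `hubbardChainEnergyDensity_le_of_umps_dual` with explicit `A, Z, c, z` and the three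
PSD facts (checked by exact `LDLᵀ` in the verifiers; in Lean either proved or carried as named
certificate hypotheses, as for the SDP rows).
-/

noncomputable section

open Matrix Finset Filter Topology
open scoped ComplexOrder BigOperators Kronecker

namespace Summit.Ventures.CertifiedManyBodySolver.Upper

open Literature.MathematicalPhysics.QuantumLattice
open Literature.MathematicalPhysics.QuantumLattice.JordanWigner
open Literature.MathematicalPhysics.QuantumLattice.ThermodynamicLimit

variable {D : ℕ}

/-! ### The finitely-correlated trial density matrix on Fock space -/

/-- The trial density matrix `ρ = Σ_l |ψ̃_l⟩⟨ψ̃_l|` on the Fock space of the open chain of `n + 2`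
sites, `ψ̃_l = toSpinVec⁻¹ (mpsOpen (n+2) A e_l r)` (METHOD-umps §2(a): `Tr_χ[K σ₀ Kᵀ]` with
`σ₀ = r r†`, read through the site-major Jordan–Wigner identification). -/
def trialDensity (A : MPSTensor 4 D) (r : Fin D → ℂ) (n : ℕ) :
    Matrix (Finset (Orb (Fin (n + 2)))) (Finset (Orb (Fin (n + 2)))) ℂ :=
  ∑ l : Fin D, vecMulVec (toSpinVec.symm (mpsOpen (n + 2) A (Pi.single l 1) r))
    (star (toSpinVec.symm (mpsOpen (n + 2) A (Pi.single l 1) r)))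

variable (A : MPSTensor 4 D) (r : Fin D → ℂ) (n : ℕ)

/-- `ρ ⪰ 0`. -/
theorem posSemidef_trialDensity : (trialDensity A r n).PosSemidef := by
  unfold trialDensity
  refine Finset.sum_induction _ (fun M => Matrix.PosSemidef M) (fun a b ha hb => ha.add hb)
    Matrix.PosSemidef.zero ?_
  intro l _
  exact posSemidef_vecMulVec_self_star _

/-- `Tr(ρ X) = mixture(toSpin X)`: Fock-space expectations of `ρ` are the tensor-side mixture
expectations of the Jordan–Wigner image. -/
theorem trace_trialDensity_mul (X : Matrix (Finset (Orb (Fin (n + 2)))) (Finset (Orb (Fin (n + 2)))) ℂ) :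
    (trialDensity A r n * X).trace = mixture A r n (toSpin X) := by
  rw [trialDensity, Finset.sum_mul, trace_sum, mixture]
  refine Finset.sum_congr rfl fun l _ => ?_
  rw [trace_vecMulVec_star_mul_eq_dotProduct_mulVec]
  have h := expect_eq X (toSpinVec.symm (mpsOpen (n + 2) A (Pi.single l 1) r))
  rw [LinearEquiv.apply_symm_apply] at h
  exact h

/-- `Tr ρ = ‖r‖²` for a left-isometric tensor. -/
theorem trace_trialDensity (hA : ∑ s, (A s)ᴴ * A s = 1) :
    (trialDensity A r n).trace = star r ⬝ᵥ r := by
  rw [← Matrix.mul_one (trialDensity A r n), trace_trialDensity_mul, map_one, mixture]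
  simp only [Matrix.one_mulVec]
  exact sum_star_mpsOpen_dotProduct_mpsOpen_eq hA (n + 2) r

variable {A r}

/-! ### Theorem U1 -/

/-- **Finite-volume form of Theorem U1**: for a left-isometric `A`, a unit `r`, `U ≥ 0` and the
three certificates, the half-filled open chain of `2n + 4` sites obeys
`E_{path(2n+4)}(2n+4) ≤ 2((n+1)c + 2z) + 3U` (METHOD-umps §2(a)–(d)). -/
theorem groundEnergyAt_pathGraph_double_le_of_umps_dual (hA : ∑ s, (A s)ᴴ * A s = 1)
    (hr : star r ⬝ᵥ r = 1) (t : ℝ) {U : ℝ} (hU : 0 ≤ U) (Z : Matrix (Fin D) (Fin D) ℂ) {c z : ℝ}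
    (hW : ((c : ℂ) • (1 : Matrix (Fin D) (Fin D) ℂ) - dualMatrix A (bondMatrix t U) Z).PosSemidef)
    (hZ₁ : ((z : ℂ) • (1 : Matrix (Fin D) (Fin D) ℂ) - Z).PosSemidef)
    (hZ₂ : ((z : ℂ) • (1 : Matrix (Fin D) (Fin D) ℂ) + Z).PosSemidef) (n : ℕ) :
    groundEnergyAt (SimpleGraph.pathGraph ((n + 2) + (n + 2))) t U ((n + 2) + (n + 2)) ≤
      2 * (((n : ℝ) + 1) * c + 2 * z) + 3 * U := by
  have htr : (trialDensity A r n).trace = 1 := by rw [trace_trialDensity A r n hA, hr]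
  have hd := groundEnergyAt_pathGraph_double_le_re_trace (n + 2) t U (posSemidef_trialDensity A r n) htr
  rw [trace_trialDensity_mul, trace_trialDensity_mul] at hd
  have hb := bookkeeping_le n hA hr t hU
  have ht : (mixture A r n (bondSum n (bondMatrix t U))).re ≤ ((n : ℝ) + 1) * c + 2 * z :=
    re_sum_star_mpsOpen_dotProduct_bondSum_mulVec_le hA hr (bondMatrix t U) Z hW hZ₁ hZ₂ n
  have hcast : (((n + 2 : ℕ) : ℝ)) = (n : ℝ) + 2 := by push_cast; ring
  rw [hcast] at hd
  linarith

/-- The limit step (e): `e ≤ ((n+1) c + K)/(n+2)` for all `n` forces `e ≤ c`. -/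
theorem le_of_forall_le_div_succ (e c K : ℝ)
    (h : ∀ n : ℕ, e ≤ (((n : ℝ) + 1) * c + K) / ((n : ℝ) + 2)) : e ≤ c := by
  by_contra hlt
  have hlt' : c < e := lt_of_not_ge hlt
  obtain ⟨n, hn⟩ := exists_nat_gt ((K - c) / (e - c))
  have hpos : (0 : ℝ) < (n : ℝ) + 2 := by positivity
  have h1 := (le_div_iff₀ hpos).mp (h n)
  have h2 := (div_lt_iff₀ (sub_pos.mpr hlt')).mp hn
  nlinarith

/-- **Theorem U1 (uMPS dual certificate ⇒ thermodynamic-limit upper bound; METHOD-umps §2).**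
Let `A : Fin 4 → M_D(ℂ)` (`D ≥ 1`) be exactly left-isometric, `Σ_s (A s)ᴴ A s = 1`, let `U ≥ 0`,
`t` real, `Z ∈ M_D(ℂ)` arbitrary, and let `c, z` be reals with
`c·1 − (Y_g + Φ(Z) − Z) ⪰ 0` (`g = bondMatrix t U`), `z·1 − Z ⪰ 0`, `z·1 + Z ⪰ 0`. Then the
half-filled Hubbard chain energy density satisfies `hubbardChainEnergyDensity t U ≤ c`.
No injectivity, gap or fixed point of `A` is used; `z` only enters the finite-size constant. -/
theorem hubbardChainEnergyDensity_le_of_umps_dual (A : MPSTensor 4 D) (hD : 0 < D)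
    (hA : ∑ s, (A s)ᴴ * A s = 1) (t : ℝ) {U : ℝ} (hU : 0 ≤ U) (Z : Matrix (Fin D) (Fin D) ℂ)
    {c z : ℝ}
    (hW : ((c : ℂ) • (1 : Matrix (Fin D) (Fin D) ℂ) - dualMatrix A (bondMatrix t U) Z).PosSemidef)
    (hZ₁ : ((z : ℂ) • (1 : Matrix (Fin D) (Fin D) ℂ) - Z).PosSemidef)
    (hZ₂ : ((z : ℂ) • (1 : Matrix (Fin D) (Fin D) ℂ) + Z).PosSemidef) :
    hubbardChainEnergyDensity t U ≤ c := by
  set r : Fin D → ℂ := Pi.single (⟨0, hD⟩ : Fin D) 1 with hr_def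
  have hr : star r ⬝ᵥ r = 1 := by
    simp [hr_def]
  refine le_of_forall_le_div_succ _ c (2 * z + 3 / 2 * U) fun n => ?_
  have hN : (1 : ℕ) ≤ (n + 2) + (n + 2) := by omega
  have hseg := hubbardChainEnergyDensity_le_segment t hU hN
  have hfin := groundEnergyAt_pathGraph_double_le_of_umps_dual hA hr t hU Z hW hZ₁ hZ₂ n
  have hpos : (0 : ℝ) < (((n + 2) + (n + 2) : ℕ) : ℝ) := by positivity
  have hcast : (((n + 2) + (n + 2) : ℕ) : ℝ) = 2 * ((n : ℝ) + 2) := by push_cast; ring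
  have h1 := hseg.trans (div_le_div_of_nonneg_right hfin hpos.le)
  rw [hcast] at h1
  refine h1.trans_eq ?_
  rw [div_eq_div_iff (by positivity) (by positivity)]
  ring

end Summit.Ventures.CertifiedManyBodySolver.Upper

end
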